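import Mathlib
import Literature.Computability.AlgebraicComplexity.MultiplicityObstructionsProofs
import Literature.Computability.AlgebraicComplexity.OrbitClosureWeights
import Literature.Computability.AlgebraicComplexity.PlethysmLifting
import Literature.Computability.AlgebraicComplexity.GCTObstructions
import Literature.NumberTheory.DiophantineGeometry.SchurWeylPlethysmOrbitWeightsProofs
import Summits.ValiantsHypothesis.ValiantsHypothesis.Theses.ValuativeGCT

/-!
# Support transfer of multiplicities (toward `NoValuativeFlip`, stmt-ValiantsHypothesis-12629)

Route `ValuativeGCT`, support item `NoValuativeFlip`. A general comparison principle for orbit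
closure multiplicities at weights of SMALL SUPPORT, which replaces the "inheritance theorems" of
the literature (BLMW 2011 §5.3; Landsberg 2017 §8.4) in the one direction needed for
no-obstruction statements:

`orbitMultiplicity_le_of_weight_support`: let `f, g` be polynomials in the variables `σ`
(`m ≠ 0`), `S ⊆ σ` a set of variables and `χ` a weight of `GL σ` vanishing outside `S`. If every
linear substitution of `g` by forms in the variables `S` only (`A · g` for matrices `A` whose rows
outside `S` vanish) lies in the orbit closure `Δ[f]`, then `mult_χ ℂ[Δ_m[g]] ≤ mult_χ ℂ[Δ_m[f]]`.

Proof (BLMW 2011 §4.4–§5.2 mechanics, all in the tree): highest-weight vectors of the quotients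
`ℂ[Δ_m[·]] = ℂ[Sym^m] ⧸ I(GL · ·)` are images of highest-weight vectors `F ∈ ℂ[Sym^m]`
(`map_highestWeightSpace_eq_of_surjective`, complete reducibility `isSemisimpleRepresentation_coordRep`),
the space of those is finite-dimensional (`finiteDimensional_highestWeightSpace_coordRep_holds`), so
by rank–nullity it suffices that `F ∈ I(GL · f) ⇒ F ∈ I(GL · g)` for such `F`. A torus weight
vector of weight `χ` involves only the coordinates `X_d` of monomials `x^d` supported in `S`
(`monWeight_eq_of_mem_weightSpace`), hence `F(q) = F(π_S q)` for the projection `π_S` onto the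
variables `S` (a diagonal substitution, `linSubst_diagonal_monomial`); and
`π_S (A · g) = (π_S A) · g ∈ Δ[f]`, on which `F` vanishes (`orbitVanishingIdeal_le_of_mem_orbitClosure`).

Used by `ValuativeGCTNoValuativeFlipBoundedLength` (no multiplicity obstruction, hence no
valuative flip, on shapes of bounded length at polynomial padding).

Sources: BLMW, SIAM J. Comput. 40 (2011), §4.4, §5.2–§5.3; J. M. Landsberg, *Geometry and
Complexity Theory* (2017), §8.4 (inheritance); Bläser–Ikenmeyer, ToC Graduate Surveys 10 (2025),
§12.4.
-/

-- `Summit.ValiantsHypothesis.ValiantsHypothesis.…` repeats a component by the D-0017 layout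
-- (single-conjunct summit), which the `dupNamespace` linter flags; the name is mandated.
set_option linter.dupNamespace false

namespace Summit.ValiantsHypothesis.ValiantsHypothesis.Theorems.NoValuativeFlip

open MvPolynomial
open Literature.NumberTheory.DiophantineGeometry Literature.Computability.AlgebraicComplexity

/-- Coefficients after the projection onto a set of variables: substituting `X i ↦ X i` for
`i ∈ S` and `X i ↦ 0` otherwise (the diagonal substitution by the indicator of `S`) keeps the
coefficient of every monomial supported in `S`. [folklore] -/
theorem coeff_linSubst_diagonal_indicator {σ : Type*} [Fintype σ] [DecidableEq σ] (S : Finset σ)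
    (q : MvPolynomial σ ℂ) {d : σ →₀ ℕ} (hd : ∀ i, i ∉ S → d i = 0) :
    coeff d (linSubst σ ℂ (Matrix.diagonal fun i => if i ∈ S then (1 : ℂ) else 0) q) =
      coeff d q := by
  set β : σ → ℂ := fun i => if i ∈ S then (1 : ℂ) else 0 with hβ
  have key : ∀ q : MvPolynomial σ ℂ, coeff d (linSubst σ ℂ (Matrix.diagonal β) q) =
      (d.prod fun i n => β i ^ n) * coeff d q := by
    intro q
    induction q using MvPolynomial.induction_on' with
    | monomial e c =>
      rw [linSubst_diagonal_monomial, coeff_smul, coeff_monomial, smul_eq_mul]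
      split_ifs with h
      · subst h; rfl
      · simp
    | add p q hp hq => rw [map_add, coeff_add, coeff_add, hp, hq, mul_add]
  have hone : (d.prod fun i n => β i ^ n) = 1 := by
    rw [Finsupp.prod]
    refine Finset.prod_eq_one fun i hi => ?_
    have hiS : i ∈ S := by
      by_contra hiS
      exact (Finsupp.mem_support_iff.mp hi) (hd i hiS)
    rw [hβ]
    simp only [hiS, if_true, one_pow]
  rw [key, hone, one_mul]

/-- **Locality of weight vectors.** A torus weight vector `F ∈ ℂ[Sym^m (ℂ^σ)]` of a weight `χ`
vanishing outside `S ⊆ σ` takes the same value at a polynomial `q` and at its projection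
`π_S q` onto the variables `S`: every coordinate `X_d` occurring in `F` has `x^d` supported in `S`
(`monWeight_eq_of_mem_weightSpace`), and those coefficients are unchanged by `π_S`. BLMW 2011
§4.4 (weights of `ℂ[Sym^m]`). -/
theorem aeval_formCoeff_eq_of_mem_weightSpace {σ : Type*} [Fintype σ] [LinearOrder σ]
    {m : ℕ} (S : Finset σ) {χ : Weight σ} (hχ : ∀ i, i ∉ S → χ i = 0)
    {F : MvPolynomial (DegIdx σ m) ℂ} (hF : F ∈ weightSpace (coordRep σ ℂ m) χ)
    (q : MvPolynomial σ ℂ) :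
    aeval (formCoeff m q) F =
      aeval (formCoeff m (linSubst σ ℂ (Matrix.diagonal fun i => if i ∈ S then (1 : ℂ) else 0) q))
        F := by
  classical
  -- every coordinate occurring in `F` is supported in `S`
  have hvars : ∀ d ∈ F.vars, ∀ i, i ∉ S → (d : DegIdx σ m).1 i = 0 := by
    intro d hd i hi
    obtain ⟨s, hs, hds⟩ := (mem_vars_iff_mem_support d).mp hd
    have hw := monWeight_eq_of_mem_weightSpace hF hs
    have h0 : monWeight s i = 0 := by rw [hw]; exact hχ i hi
    rw [monWeight_apply, neg_eq_zero, Nat.cast_eq_zero, Finset.sum_eq_zero_iff] at h0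
    have h1 := h0 d hds
    exact (mul_eq_zero.mp h1).resolve_left (Finsupp.mem_support_iff.mp hds)
  change (aeval (formCoeff m q)).toRingHom F = (aeval (formCoeff m _)).toRingHom F
  refine hom_congr_vars (by ext; simp) (fun d hd _ => ?_) rfl
  simp only [AlgHom.toRingHom_eq_coe, RingHom.coe_coe, aeval_X, formCoeff_apply]
  exact (coeff_linSubst_diagonal_indicator S q (hvars d hd)).symm

/-- **Support transfer of multiplicities.** Let `f g` be polynomials in the variables `σ` over `ℂ`,
`m ≠ 0`, `S ⊆ σ`, and `χ` a weight of `GL σ` vanishing outside `S`. If `A · g ∈ Δ[f]` for every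
matrix `A` whose rows outside `S` vanish (i.e. every substitution of `g` by linear forms in the
variables `S`), then `mult_χ ℂ[Δ_m[g]] ≤ mult_χ ℂ[Δ_m[f]]`. (The direction of the inheritance
principle, BLMW 2011 §5.3 / Landsberg 2017 §8.4, that no-obstruction statements need; proved from
the lifting of highest-weight vectors and the locality of weight vectors.) -/
theorem orbitMultiplicity_le_of_weight_support {σ : Type*} [Fintype σ] [LinearOrder σ]
    (f g : MvPolynomial σ ℂ) {m : ℕ} (hm : m ≠ 0) (S : Finset σ)
    (hS : ∀ A : Matrix σ σ ℂ, (∀ i, i ∉ S → ∀ j, A i j = 0) → linSubst σ ℂ A g ∈ orbitClosure f)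
    (χ : Weight σ) (hχ : ∀ i, i ∉ S → χ i = 0) :
    orbitMultiplicity ℂ g m χ ≤ orbitMultiplicity ℂ f m χ := by
  classical
  set V : Submodule ℂ (MvPolynomial (DegIdx σ m) ℂ) := highestWeightSpace (coordRep σ ℂ m) χ
    with hV
  haveI : FiniteDimensional ℂ V := finiteDimensional_highestWeightSpace_coordRep_holds hm χ
  -- the two quotient maps as intertwining maps out of `ℂ[Sym^m]`
  let πf : (coordRep σ ℂ m).IntertwiningMap (orbitCoordRep f m) :=
    ⟨(Ideal.Quotient.mkₐ ℂ (orbitVanishingIdeal f m)).toLinearMap, fun _ => LinearMap.ext fun _ => rfl⟩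
  let πg : (coordRep σ ℂ m).IntertwiningMap (orbitCoordRep g m) :=
    ⟨(Ideal.Quotient.mkₐ ℂ (orbitVanishingIdeal g m)).toLinearMap, fun _ => LinearMap.ext fun _ => rfl⟩
  have hmapf := map_highestWeightSpace_eq_of_surjective πf (Ideal.Quotient.mkₐ_surjective ℂ _)
    (isSemisimpleRepresentation_coordRep m) χ
  have hmapg := map_highestWeightSpace_eq_of_surjective πg (Ideal.Quotient.mkₐ_surjective ℂ _)
    (isSemisimpleRepresentation_coordRep m) χ
  -- rank–nullity for the restrictions to `V`
  have hrf := LinearMap.finrank_range_add_finrank_ker (πf.toLinearMap ∘ₗ V.subtype)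
  have hrg := LinearMap.finrank_range_add_finrank_ker (πg.toLinearMap ∘ₗ V.subtype)
  rw [LinearMap.range_comp, Submodule.range_subtype] at hrf hrg
  -- the core: a highest-weight vector of weight `χ` vanishing on `GL · f` vanishes on `GL · g`
  have core : ∀ F ∈ V, F ∈ orbitVanishingIdeal f m → F ∈ orbitVanishingIdeal g m := by
    intro F hF hFI
    rw [mem_orbitVanishingIdeal_iff]
    intro A
    set D : Matrix σ σ ℂ := Matrix.diagonal fun i => if i ∈ S then (1 : ℂ) else 0 with hD
    have hFw : F ∈ weightSpace (coordRep σ ℂ m) χ := highestWeightSpace_le_weightSpace _ _ hF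
    rw [aeval_formCoeff_eq_of_mem_weightSpace S hχ hFw, linSubstRep_apply, ← AlgHom.comp_apply,
      ← linSubst_mul]
    -- `(D * A) · g ∈ Δ[f]`, so `I(GL · f) ≤ I(GL · ((D * A) · g))`, and `F` vanishes at that point
    have hrows : ∀ i, i ∉ S → ∀ j, (D * (A : Matrix σ σ ℂ)) i j = 0 := by
      intro i hi j
      rw [hD, Matrix.diagonal_mul, if_neg hi, zero_mul]
    have hmem := hS _ hrows
    have hFI' := orbitVanishingIdeal_le_of_mem_orbitClosure (m := m) hmem hFI
    have := mem_orbitVanishingIdeal_iff.mp hFI' 1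
    simpa only [map_one, Module.End.one_apply] using this
  -- kernel inclusion and the count
  have hker : LinearMap.ker (πf.toLinearMap ∘ₗ V.subtype) ≤
      LinearMap.ker (πg.toLinearMap ∘ₗ V.subtype) := by
    intro F hF
    rw [LinearMap.mem_ker, LinearMap.comp_apply] at hF ⊢
    have hFI : (F : MvPolynomial (DegIdx σ m) ℂ) ∈ orbitVanishingIdeal f m :=
      Ideal.Quotient.eq_zero_iff_mem.mp hF
    exact Ideal.Quotient.eq_zero_iff_mem.mpr (core F F.2 hFI)
  have hfin := Submodule.finrank_mono hker
  rw [hV] at hrf hrg hfin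
  unfold orbitMultiplicity hwMultiplicity
  rw [← hmapf, ← hmapg]
  omega

end Summit.ValiantsHypothesis.ValiantsHypothesis.Theorems.NoValuativeFlip
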